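import Summits.MatrixMultiplication.MatrixMultiplication.Theorems.ObstructionDescentSignPropagation

set_option linter.dupNamespace false

/-!
# Obstruction descent, part AE — EVEN LEVELS: the propagation law where no pair law exists (level 2 from Cayley's `Δ`)

`route-MatrixMultiplication-ObstructionDescent`, aside `InvariantSaturation` (stmt 32282); decomp-mm lens-3, NODE-g16.

Scope note for parts AC/AD.  For ODD levels the tree already has the PAIR LAW (parts K–P,
`evalT_eq_zero_of_odd_level_corner`: `R_k(N) ⊆ I(σ_r)` for `(k−1)(r−1) < k(N−1)`), which for `k = 3` and `N ≥ 6` covers the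
whole rank range `≤ N + 2` of part AD's level-3 sign law — there the sign law is `0 = 0`, and its informative instance is
`N = 5`, rank `7` (part AA).  EVEN levels are non-empty at format `2` (`not_mem_emptyLevels_two_two_of_even`: powers of
Cayley's hyperdeterminant `Δ`), so no pair law applies to them; for even `k` the propagation law of part AD is the only
structural statement about the tower in the tree.  This file records its first instance, LEVEL `2` from FORMAT `2`:

* **`evalT_permT_level_two`** — if `σ` acts by `χ` on `R₂(2)` (classically `R₂(2) = ℂ·Δ`, and `Δ` is symmetric under all
  permutations of the three indices, `χ = 1`), then every level-2 highest weight vector `f` of every format `N ≥ 2`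
  satisfies `f(σ·t) = χ·f(t)` for all `t` of rank `≤ N + 2`; `evalT_permT_level_two_eq` (`χ = 1`: `S₃`-SYMMETRY of all
  level-2 vectors on `σ_{N+2}` — at `N = 3`, where `σ₅ = ℂ³⊗ℂ³⊗ℂ³`, this says the degree-6 invariant of `3 ⊗ 3 ⊗ 3` is
  `σ`-symmetric iff `Δ` is); corner forms;
* with part AB, if `R₂(2)` is a line `ℂ·D`: cyclic slot symmetry of all level-2 vectors on `σ_{N+2}` and one sign for the
  transpositions (`evalT_permT_cycle_level_two`, `exists_sign_level_two`);
* the general even-level schedule `evalT_permT_even_level_propagate` (`(k−1)(c+1) < k(N₀+1)`, `c ≤ …`, from any format `N₀`).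

[cite: GelfandKapranovZelevinsky1994, Ch. 14 §1] (Cayley's hyperdeterminant and its symmetry), [cite: BremnerHuOeding2014, §1]
(the invariants of `3 ⊗ 3 ⊗ 3` in degrees 6, 9, 12), [cite: BurgisserIkenmeyer2011, §3.1–3.2], [cite: BurgisserIkenmeyer2017, §5].
-/

noncomputable section

open scoped BigOperators
open Finset

namespace Summit.MatrixMultiplication.MatrixMultiplication.Theorems.ObstructionCalculus

open Literature.Computability.AlgebraicComplexity (tensorRank unitTensor)

section LevelTwo

/-- **General linear schedule.**  If `σ` acts by `χ` on `R_k(N₀)` and `(k−1)·(n + 1 + c) < k·(N₀ + n + 1)` for every `n`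
(it suffices that `(k−1)(c+1) < k(N₀+1)` when `k ≥ 1`), then `f(σ·t) = χ·f(t)` for every `f ∈ R_k(N₀+n)` and `R(t) ≤ n + c`.
[this node] -/
theorem evalT_permT_propagate_linear {N₀ k c : ℕ} (hc : ∀ n : ℕ, (k - 1) * (n + 1 + c) < k * (N₀ + n + 1))
    (σ : Equiv.Perm (Fin 3)) {χ : ℂ}
    (hV : ∀ g ∈ hwvSpace (rectType N₀ N₀ k) (k * N₀), MvPolynomial.rename (slotPerm σ) g = χ • g) (n : ℕ)
    {f : MvPolynomial (Idx (N₀ + n)) ℂ} (hf : f ∈ hwvSpace (rectType (N₀ + n) (N₀ + n) k) (k * (N₀ + n)))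
    {t : Tensor ℂ (N₀ + n)} (ht : tensorRank t ≤ n + c) : evalT (permT σ t) f = χ * evalT t f :=
  lowRankChar_iterate_of_slotChar σ (fun n => n + c) hV (fun n => ⟨by simpa only [Nat.add_right_comm] using hc n, by omega⟩)
    n f hf t ht

/-- **LEVEL 2 FROM FORMAT 2.**  If `σ` acts by `χ` on `R₂(2)` (`= ℂ·Δ`, Cayley's hyperdeterminant; `χ = 1`), then every level-2
highest weight vector `f` of format `2 + n` satisfies `f(σ·t) = χ·f(t)` for `R(t) ≤ n + 4`. [this node] -/
theorem evalT_permT_level_two_of_two (σ : Equiv.Perm (Fin 3)) {χ : ℂ}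
    (hV : ∀ g ∈ hwvSpace (rectType 2 2 2) (2 * 2), MvPolynomial.rename (slotPerm σ) g = χ • g) (n : ℕ)
    {f : MvPolynomial (Idx (2 + n)) ℂ} (hf : f ∈ hwvSpace (rectType (2 + n) (2 + n) 2) (2 * (2 + n)))
    {t : Tensor ℂ (2 + n)} (ht : tensorRank t ≤ n + 4) : evalT (permT σ t) f = χ * evalT t f :=
  evalT_permT_propagate_linear (c := 4) (fun n => by omega) σ hV n hf ht

/-- **Format-`N` form:** `σ` acts by `χ` on `R₂(2)` ⇒ for every `N ≥ 2`, every `f ∈ R₂(N)` and every `t` of rank `≤ N + 2`: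
`f(σ·t) = χ·f(t)`. [this node] -/
theorem evalT_permT_level_two (σ : Equiv.Perm (Fin 3)) {χ : ℂ}
    (hV : ∀ g ∈ hwvSpace (rectType 2 2 2) (2 * 2), MvPolynomial.rename (slotPerm σ) g = χ • g) {N : ℕ} (hN : 2 ≤ N)
    {f : MvPolynomial (Idx N) ℂ} (hf : f ∈ hwvSpace (rectType N N 2) (2 * N)) {t : Tensor ℂ N}
    (ht : tensorRank t ≤ N + 2) : evalT (permT σ t) f = χ * evalT t f := by
  obtain ⟨n, rfl⟩ : ∃ n, N = 2 + n := ⟨N - 2, by omega⟩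
  exact evalT_permT_level_two_of_two σ hV n hf (by omega)

/-- **`S₃`-symmetry of all level-2 vectors on `σ_{N+2}`** (the case `χ = 1`: `Δ^σ = Δ`). [this node] -/
theorem evalT_permT_level_two_eq (σ : Equiv.Perm (Fin 3))
    (hV : ∀ g ∈ hwvSpace (rectType 2 2 2) (2 * 2), MvPolynomial.rename (slotPerm σ) g = g) {N : ℕ} (hN : 2 ≤ N)
    {f : MvPolynomial (Idx N) ℂ} (hf : f ∈ hwvSpace (rectType N N 2) (2 * N)) {t : Tensor ℂ N}
    (ht : tensorRank t ≤ N + 2) : evalT (permT σ t) f = evalT t f := by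
  have h := evalT_permT_level_two σ (χ := 1) (fun g hg => by rw [one_smul]; exact hV g hg) hN hf ht
  rwa [one_mul] at h

/-- Corner form at any ambient format `m ≥ N ≥ 2`. [this node] -/
theorem evalT_permT_level_two_corner (σ : Equiv.Perm (Fin 3)) {χ : ℂ}
    (hV : ∀ g ∈ hwvSpace (rectType 2 2 2) (2 * 2), MvPolynomial.rename (slotPerm σ) g = χ • g) {N m : ℕ} (hN : 2 ≤ N)
    (hNm : N ≤ m) {F : MvPolynomial (Idx m) ℂ} (hF : F ∈ hwvSpace (rectType m N 2) (2 * N)) {s : Tensor ℂ m}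
    (hs : tensorRank s ≤ N + 2) : evalT (permT σ s) F = χ * evalT s F :=
  lowRankChar_corner hNm σ (fun _ hf _ ht => evalT_permT_level_two σ hV hN hf ht) F hF s hs

/-- A level-2 vector of format `N ≥ 2` whose own `σ`-character differs from that of `R₂(2)` dies on `σ_{N+2}`. [this node] -/
theorem evalT_eq_zero_level_two_of_slotChar_ne (σ : Equiv.Perm (Fin 3)) {χ χf : ℂ} (hne : χf ≠ χ)
    (hV : ∀ g ∈ hwvSpace (rectType 2 2 2) (2 * 2), MvPolynomial.rename (slotPerm σ) g = χ • g) {N : ℕ} (hN : 2 ≤ N)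
    {f : MvPolynomial (Idx N) ℂ} (hf : f ∈ hwvSpace (rectType N N 2) (2 * N))
    (hfχ : MvPolynomial.rename (slotPerm σ) f = χf • f) {t : Tensor ℂ N} (ht : tensorRank t ≤ N + 2) :
    evalT t f = 0 := by
  have h := evalT_permT_level_two σ hV hN hf ht
  rw [evalT_permT_of_slotChar σ hfχ] at h
  have h' : (χf - χ) * evalT t f = 0 := by rw [sub_mul, h, sub_self]
  exact (mul_eq_zero.mp h').resolve_left (sub_ne_zero.mpr hne)

/-- **Cyclic slot symmetry of all level-2 vectors** (if `R₂(2)` is a line `ℂ·D`, `D ≠ 0`): for every `N ≥ 2`, every `f ∈ R₂(N)` is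
invariant under cyclic rotation of the slots on tensors of rank `≤ N + 2`. [this node] -/
theorem evalT_permT_cycle_level_two {D : MvPolynomial (Idx 2) ℂ} (hDm : D ∈ hwvSpace (rectType 2 2 2) (2 * 2))
    (hD0 : D ≠ 0) (hline : ∀ g ∈ hwvSpace (rectType 2 2 2) (2 * 2), ∃ c : ℂ, g = c • D) {N : ℕ} (hN : 2 ≤ N)
    {f : MvPolynomial (Idx N) ℂ} (hf : f ∈ hwvSpace (rectType N N 2) (2 * N)) {t : Tensor ℂ N}
    (ht : tensorRank t ≤ N + 2) :
    evalT (permT (Equiv.swap 0 1 * Equiv.swap 1 2) t) f = evalT t f ∧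
      evalT (permT (Equiv.swap 1 2 * Equiv.swap 0 1) t) f = evalT t f := by
  obtain ⟨ε, -, -, -, -, hc, hc'⟩ := exists_sign_of_level_line hDm hD0 hline
  exact ⟨evalT_permT_level_two_eq _ hc hN hf ht, evalT_permT_level_two_eq _ hc' hN hf ht⟩

/-- **One sign for the transpositions at all formats** (if `R₂(2)` is a line): `∃ ε = ±1`, `f(τ·t) = ε·f(t)` for every `N ≥ 2`,
`f ∈ R₂(N)`, transposition `τ`, `R(t) ≤ N + 2`.  (For `D = Δ`: `ε = 1`.) [this node] -/
theorem exists_sign_level_two {D : MvPolynomial (Idx 2) ℂ} (hDm : D ∈ hwvSpace (rectType 2 2 2) (2 * 2))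
    (hD0 : D ≠ 0) (hline : ∀ g ∈ hwvSpace (rectType 2 2 2) (2 * 2), ∃ c : ℂ, g = c • D) :
    ∃ ε : ℂ, (ε = 1 ∨ ε = -1) ∧ ∀ (N : ℕ), 2 ≤ N → ∀ f ∈ hwvSpace (rectType N N 2) (2 * N), ∀ t : Tensor ℂ N,
      tensorRank t ≤ N + 2 → ∀ i j : Fin 3, i ≠ j → evalT (permT (Equiv.swap i j) t) f = ε * evalT t f := by
  obtain ⟨ε, hε, h01, h02, h12, -, -⟩ := exists_sign_of_level_line hDm hD0 hline
  refine ⟨ε, hε, fun N hN f hf t ht i j hij => ?_⟩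
  rcases swap_cases i j hij with h | h | h <;> rw [h]
  · exact evalT_permT_level_two _ h01 hN hf ht
  · exact evalT_permT_level_two _ h02 hN hf ht
  · exact evalT_permT_level_two _ h12 hN hf ht

end LevelTwo

end Summit.MatrixMultiplication.MatrixMultiplication.Theorems.ObstructionCalculus
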